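import Mathlib
import HarnessLib
import Summits.NavierStokesRegularity.NavierStokesRegularity.Theorems.UnthreadedDoorAntidynamoWallOneInstantZonal
import Summits.NavierStokesRegularity.NavierStokesRegularity.Theorems.UnthreadedDoorAntidynamoCompositionModuloWall
import Summits.NavierStokesRegularity.NavierStokesRegularity.Theorems.LocalSineTubeDoorProfileAlignedWindowRigidityAncient

/-!
# Route `UnthreadedDoor` / `ThreadingFlux`, crux `PoloidalLiouville` (stmt-NavierStokesRegularity-1222), antidynamo v2 skeleton (sha16 `4ebf5683127b`),
# WALL `stub_scalarLiouville`: THE WALL IN PRINT'S VOCABULARY — a poloidal Liouville theorem for MILD bounded ancient solutions with a MOVING centre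

Support file (seat leafhand-ns-unthreadeddoor-2 g2, cell decomp-ns), `--supports stmt-NavierStokesRegularity-1222 --as helper`; theorems only.

What the tree's wall asks, once the parasitic drift of the duality class is quotiented out (Oseen gauge theorem `Theorems.oseen_gauge_of_aestronglyMeasurable`,
crux `TypeIliouvilleL`): `StubScalarLiouville` — hence the crux `PoloidalLiouville` of both routes — FOLLOWS from

  **(ML) MILD MOVING-CENTRE POLOIDAL LIOUVILLE.**  Let `w` be a bounded ancient MILD solution in the sense of KNSS 2009 §4 (i) / Albritton–Barker 2019
  (continuous and uniformly bounded on `(−∞,0) × ℝ³`, weakly divergence-free slices, Oseen integral identity `w(t) = e^{(t−s)Δ}w(s) − B¹_s(w,w)(t)` for all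
  `s < t < 0`; such a field is automatically jointly real-analytic — hypothesis supplied), with smooth slices, and let `p : (−∞,0) → ℝ³` be a CONTINUOUS path.
  If at every `t < 0` the vorticity `curl w(t)` is tangent to the spheres about `p(t)`, then `curl w ≡ 0`.

(`stubScalarLiouville_of_mild_movingCentre`, `poloidalLiouville_of_mild_movingCentre`).  The moving centre is the honest price of the duality class: the
gauge's frame path `A(t)` is only known to be continuous, and the tangency centre of the mild representative is `p(t) = x₀ − A(t)`.  (A centre moving with
CONSTANT velocity is removable by a Galilean boost of the mild class, `Theorems.stub_oseen_const_boost`; a fixed centre is KNSS's setting plus «no symmetry».)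
All one-instant closers of this seat (`…WallOneInstantZonal/Symmetry/Axisymmetric/RigidMotion`) transport verbatim to (ML).

HONEST LABEL: a by-name reduction (Oseen gauge + bookkeeping); (ML) is OPEN in print (it contains KNSS 2009 Thm 5.2 as the axisymmetric-no-swirl, fixed-centre
case); nothing here proves `stub_scalarLiouville`, `PoloidalLiouville` (1222), or bears on Navier–Stokes regularity; no summit statement is proved.
[cite: KochNadirashviliSereginSverak2009, §1 p. 3, §4 (i)–(ii), Thm 5.2 (arXiv:0709.3599 pp. 3, 8–10); AlbrittonBarker2019, §1; LemarieRieusset2016, Thm. 9.12]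
-/

noncomputable section

-- the summit and its single sub-problem share the name (CONVENTIONS §1)
set_option linter.dupNamespace false

open scoped Topology InnerProductSpace RealInnerProductSpace ContDiff
open Filter Set Function Metric MeasureTheory
open Literature.Analysis Literature.Analysis.FluidPDE

namespace Summit.NavierStokesRegularity.NavierStokesRegularity.Theorems.PoloidalLiouville.Antidynamo

open Summit.NavierStokesRegularity.NavierStokesRegularity.Theorems.PoloidalLiouville.NetFlux (E3)
open Summit.NavierStokesRegularity.NavierStokesRegularity.Theorems.LocalSineTubeDoorProfileAlignedWindowRigidityAncient
  (analyticOnNhd_uncurry)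

namespace OneInstant

/-- ★★ **THE WALL'S VORTICITY CONCLUSION FROM (ML).**  If the mild moving-centre poloidal Liouville theorem (ML) of the module docstring holds, then every
flow of the wall's class (bounded ancient mild in the duality sense, measurable slices, jointly smooth, vorticity tangent to the spheres about a FIXED `x₀`) is
irrotational: its Oseen-gauge representative `w` (`v(t) = w(t, · − A(t)) + c(t)`) is a mild bounded ancient solution, jointly analytic, with smooth slices
and vorticity tangent to the spheres about the continuous path `p(t) = x₀ − A(t)`. [cite: KochNadirashviliSereginSverak2009, §1 p. 3, §4 (i)–(ii) (arXiv:0709.3599 pp. 3, 8); LemarieRieusset2016, Thm. 9.12] -/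
theorem curl_eq_zero_of_mild_movingCentre
    (hML : ∀ (w : ℝ → EuclideanSpace ℝ (Fin 3) → EuclideanSpace ℝ (Fin 3)) (p : ℝ → EuclideanSpace ℝ (Fin 3)),
      ContinuousOn (Function.uncurry w) (Set.Iio 0 ×ˢ Set.univ) →
      (∃ K : ℝ, ∀ t < 0, ∀ y, ‖w t y‖ ≤ K) →
      (∀ t < 0, IsWeaklyDivFree (w t)) →
      (∀ s t : ℝ, s < t → t < 0 → ∀ y,
        w t y = UnboundedOperators.heatExtension (w s) (t - s) y - oseenDuhamel 1 s w w t y) →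
      AnalyticOnNhd ℝ (Function.uncurry w) (Set.Iio (0 : ℝ) ×ˢ (Set.univ : Set (EuclideanSpace ℝ (Fin 3)))) →
      (∀ t < 0, ContDiff ℝ (⊤ : ℕ∞) (w t)) →
      Continuous p →
      (∀ t < 0, ∀ y, ⟪y - p t, curl (w t) y⟫ = 0) →
      ∀ t < 0, ∀ y, curl (w t) y = 0)
    (v : ℝ → EuclideanSpace ℝ (Fin 3) → EuclideanSpace ℝ (Fin 3)) (x₀ : EuclideanSpace ℝ (Fin 3))
    (hB : Literature.Analysis.FluidPDE.IsBoundedAncientMildSolution 1 v)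
    (hm : ∀ t < 0, AEStronglyMeasurable (v t) volume)
    (hsm : ContDiffOn ℝ (⊤ : ℕ∞) (Function.uncurry v) (Set.Iio 0 ×ˢ Set.univ))
    (hun : ∀ t < 0, ∀ x, ⟪x - x₀, curl (v t) x⟫ = 0) :
    ∀ t < 0, ∀ x, curl (v t) x = 0 := by
  have hsm' : IsSmoothSpaceTimeOn (Iio 0) v := hsm
  -- ## the Oseen gauge, everywhere
  obtain ⟨w, A, c, -, hwc, ⟨K, hK⟩, hwdiv, hwmild, hA, hrep⟩ := Theorems.oseen_gauge_of_aestronglyMeasurable v hB hm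
  have hrep' : ∀ s < 0, ∀ y, v s y = w s (y - A s) + c s :=
    fun s hs y => CellFlux.galilean_rep_everywhere hsm.continuousOn hwc hrep hs y
  have hws : ∀ s < 0, w s = fun y => v s (y + A s) - c s := fun s hs => by
    funext y
    have h := hrep' s hs (y + A s)
    rw [add_sub_cancel_right] at h
    rw [h, add_sub_cancel_right]
  have hw_smooth : ∀ s < 0, ContDiff ℝ (⊤ : ℕ∞) (w s) := fun s hs => by
    rw [hws s hs]
    exact ((hsm'.contDiff_slice hs).comp (contDiff_id.add contDiff_const)).sub contDiff_const
  have hw_curl : ∀ s < 0, ∀ y, curl (w s) y = curl (v s) (y + A s) := fun s hs y => by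
    rw [hws s hs, CellFlux.curl_comp_add_sub_const]
  -- ## the representative is analytic and its vorticity is tangent to the spheres about `p t = x₀ − A t`
  have hbdd : ∀ δ : ℝ, 0 < δ → ∃ B : ℝ, ∀ t < -δ, ∀ y : EuclideanSpace ℝ (Fin 3), ‖w t y‖ ≤ B := fun δ hδ =>
    ⟨K, fun t ht y => hK t (by linarith) y⟩
  have hwA : AnalyticOnNhd ℝ (Function.uncurry w) (Set.Iio (0 : ℝ) ×ˢ (Set.univ : Set (EuclideanSpace ℝ (Fin 3)))) :=
    analyticOnNhd_uncurry hwc hbdd hwmild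
  have htan : ∀ t < 0, ∀ y, ⟪y - (x₀ - A t), curl (w t) y⟫ = 0 := fun t ht y => by
    rw [hw_curl t ht]
    have h := hun t ht (y + A t)
    have e : y + A t - x₀ = y - (x₀ - A t) := by abel
    rwa [e] at h
  have hw0 := hML w (fun t => x₀ - A t) hwc ⟨K, hK⟩ hwdiv hwmild hwA hw_smooth (continuous_const.sub hA) htan
  -- ## back to `v`
  intro t ht x
  have h := hw0 t ht (x - A t)
  rwa [hw_curl t ht, sub_add_cancel] at h

/-- ★★ **THE WALL FROM (ML), BY NAME.** [cite: KochNadirashviliSereginSverak2009, §1 p. 3, §4 (i)–(ii), Thm 5.2 (arXiv:0709.3599 pp. 3, 8–10)] -/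
theorem stubScalarLiouville_of_mild_movingCentre
    (hML : ∀ (w : ℝ → EuclideanSpace ℝ (Fin 3) → EuclideanSpace ℝ (Fin 3)) (p : ℝ → EuclideanSpace ℝ (Fin 3)),
      ContinuousOn (Function.uncurry w) (Set.Iio 0 ×ˢ Set.univ) →
      (∃ K : ℝ, ∀ t < 0, ∀ y, ‖w t y‖ ≤ K) →
      (∀ t < 0, IsWeaklyDivFree (w t)) →
      (∀ s t : ℝ, s < t → t < 0 → ∀ y,
        w t y = UnboundedOperators.heatExtension (w s) (t - s) y - oseenDuhamel 1 s w w t y) →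
      AnalyticOnNhd ℝ (Function.uncurry w) (Set.Iio (0 : ℝ) ×ˢ (Set.univ : Set (EuclideanSpace ℝ (Fin 3)))) →
      (∀ t < 0, ContDiff ℝ (⊤ : ℕ∞) (w t)) →
      Continuous p →
      (∀ t < 0, ∀ y, ⟪y - p t, curl (w t) y⟫ = 0) →
      ∀ t < 0, ∀ y, curl (w t) y = 0) :
    StubScalarLiouville := by
  intro v x₀ T hB hm hsm _hT _hTb hrep _hE
  have hun : ∀ t < 0, ∀ x, ⟪x - x₀, curl (v t) x⟫ = 0 := fun t ht x => by
    rw [hrep t ht x]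
    simp [cross, crossProduct, PiLp.inner_apply, Fin.sum_univ_three]
    ring
  intro t ht x
  rw [← hrep t ht x]
  exact curl_eq_zero_of_mild_movingCentre hML v x₀ hB hm hsm hun t ht x

/-- ★★ **… AND THE CRUX FROM (ML)** (route `UnthreadedDoor` decl; composition p793469 by name). -/
theorem poloidalLiouville_of_mild_movingCentre
    (hML : ∀ (w : ℝ → EuclideanSpace ℝ (Fin 3) → EuclideanSpace ℝ (Fin 3)) (p : ℝ → EuclideanSpace ℝ (Fin 3)),
      ContinuousOn (Function.uncurry w) (Set.Iio 0 ×ˢ Set.univ) →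
      (∃ K : ℝ, ∀ t < 0, ∀ y, ‖w t y‖ ≤ K) →
      (∀ t < 0, IsWeaklyDivFree (w t)) →
      (∀ s t : ℝ, s < t → t < 0 → ∀ y,
        w t y = UnboundedOperators.heatExtension (w s) (t - s) y - oseenDuhamel 1 s w w t y) →
      AnalyticOnNhd ℝ (Function.uncurry w) (Set.Iio (0 : ℝ) ×ˢ (Set.univ : Set (EuclideanSpace ℝ (Fin 3)))) →
      (∀ t < 0, ContDiff ℝ (⊤ : ℕ∞) (w t)) →
      Continuous p →
      (∀ t < 0, ∀ y, ⟪y - p t, curl (w t) y⟫ = 0) →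
      ∀ t < 0, ∀ y, curl (w t) y = 0) :
    Summit.NavierStokesRegularity.NavierStokesRegularity.Theses.UnthreadedDoor.PoloidalLiouville :=
  poloidalLiouville_of_stubScalarLiouville' (stubScalarLiouville_of_mild_movingCentre hML)

end OneInstant

end Summit.NavierStokesRegularity.NavierStokesRegularity.Theorems.PoloidalLiouville.Antidynamo

end
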